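import Summits.NavierStokesRegularity.NavierStokesRegularity.Theses.CertifiedBlowup
import Summits.NavierStokesRegularity.NavierStokesRegularity.Theorems.AxisymmetricSwirlRegularity
import Summits.NavierStokesRegularity.NavierStokesRegularity.Theorems.CertifiedBlowupCertifiedBlowupAxisymBlowupClayOrBlowup
import Summits.NavierStokesRegularity.NavierStokesRegularity.Theorems.CertifiedBlowupCertifiedBlowupAxisymBlowupOfAmplification
import Summits.NavierStokesRegularity.NavierStokesRegularity.Theorems.CertifiedBlowupCertifiedBlowupAxisymBlowupAmplificationOf

/-!
# The crux `CertifiedBlowupAxisymBlowup` (stmt-NavierStokesRegularity-0727) is EXACTLY the negation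
# of the conjecture leaf `AxisymmetricSwirlRegularity` (ns.S25, wall item stmt-NavierStokesRegularity-11332)

Theorems file landed `--supports stmt-NavierStokesRegularity-0727`, line `compact-amplification`
(continuation lead c1). Up to now the tree knew `AX → ¬crux` (the proved kill edge
`CertifiedBlowupKillEdge_holds` with the discharged Clay-class uniqueness `BlowupClayUniqueness_holds`)
and the refuters' reduction probes recorded `crux = ¬AX modulo local well-posedness`. The datum-wise
Clay dichotomy `clayOrBlowup` (`…ClayOrBlowup.lean`: every Clay datum has a global classical
bounded-energy solution or launches a maximal Leray–Hopf classical solution of finite lifespan)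
removes the proviso:

* `certifiedBlowupAxisymBlowup_iff_not_axisymmetricSwirlRegularity`:
  `CertifiedBlowupAxisymBlowup ↔ ¬ AxisymmetricSwirlRegularity` (transitional `Literature` copy),
* `certifiedBlowupAxisymBlowup_iff_not_axisymmetricSwirlRegularity_summit`: the same against the
  canonical conjecture leaf `Summit.NavierStokesRegularity.NavierStokesRegularity.AxisymmetricSwirlRegularity`,
* `certifiedBlowupAxisymBlowup_iff_not_axisymmetricSwirlRegularityWall`: the same against the route
  item `AxisymmetricSwirlRegularityWall` (stmt-NavierStokesRegularity-11332),
* `amplification_iff_certifiedBlowupAxisymBlowup`, `amplification_iff_not_axisymmetricSwirlRegularity`: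
  the line's one open stub C⁺ (`stub_amplification`, unbounded enstrophy amplification over a compact
  axisymmetric Schwartz family) is equivalent to the crux (both directions landed:
  `certifiedBlowupAxisymBlowup_of_amplification`, `amplification_of_certifiedBlowupAxisymBlowup`) and
  hence to `¬ AxisymmetricSwirlRegularity`.

* `axisymmetricSwirlRegularity_iff_apriori_enstrophy_bound`: contrapositive reading — ns.S25 holds
  iff the enstrophy of Tao-class solutions on `[0, T] ⊆ [0, 1]` is bounded uniformly over every
  compact axisymmetric Schwartz data family (qualitative ⇔ quantitative regularity, Tao 2013
  Thm. 1.20 (vi), inside the axisymmetric class).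

So the three statements — crux 0727, stub C⁺, ¬(wall 11332) — are one open problem in three
costumes (axisymmetric Navier–Stokes blow-up with swirl), kernel-checked; proving any settles all,
and proving the wall refutes the crux.

## References

* G. Koch, N. Nadirashvili, G. Seregin, V. Šverák, Acta Math. 203 (2009), §§5–6 (the axisymmetric
  problem with swirl).
* T. Tao, Anal. PDE 6 (2013) = arXiv:1108.1165, Thm. 1.20 (qualitative ⇔ quantitative regularity).
* P. G. Lemarié-Rieusset, *The Navier–Stokes Problem in the 21st Century*, CRC 2016, Prop. 12.3,
  Thm. 15.1.
-/

set_option linter.dupNamespace false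

noncomputable section

open MeasureTheory Set Function Filter Topology Metric
open scoped ENNReal NNReal ContDiff

namespace Summit.NavierStokesRegularity.NavierStokesRegularity.Theorems.CertifiedBlowupAxisymBlowup.CompactAmplification

open Literature.Analysis.FluidPDE
open Summit.NavierStokesRegularity.NavierStokesRegularity.Theses.CertifiedBlowup

/-- **The two branches of the Clay dichotomy exclude each other** (Clay-class uniqueness X5b,
`BlowupClayUniqueness_holds`): a datum with a global classical bounded-energy solution `(U, P)`
launches no maximal Leray–Hopf classical solution of finite lifespan — `U` agrees with it on
`[0, T)` and, restricted to `[0, T + 1)`, continues it past `T`. So `clayOrBlowup` is an exclusive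
disjunction, datum by datum. [folklore] -/
theorem clayOrBlowup_exclusive {ν : ℝ} (hν : 0 < ν)
    {u₀ : EuclideanSpace ℝ (Fin 3) → EuclideanSpace ℝ (Fin 3)} (hdec : HasRapidSpatialDecay u₀)
    {U : ℝ → EuclideanSpace ℝ (Fin 3) → EuclideanSpace ℝ (Fin 3)} {P : ℝ → EuclideanSpace ℝ (Fin 3) → ℝ}
    (hU : IsClassicalNSSolutionOn (Ici 0) ν 0 U P) (hU0 : U 0 = u₀) (hE : HasBoundedEnergy U)
    {T : ℝ} (hT : 0 < T) {u : ℝ → EuclideanSpace ℝ (Fin 3) → EuclideanSpace ℝ (Fin 3)}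
    {p : ℝ → EuclideanSpace ℝ (Fin 3) → ℝ} (hmax : IsMaximalSmoothSolution ν 0 u p T)
    (hLH : IsLerayHopfOn T ν 0 u₀ u) (hu0 : u 0 = u₀) : False := by
  obtain ⟨hns, hUs, hPs⟩ := isNavierStokesSolution_and_smooth_iff.2 ⟨hU, hU0⟩
  have heq : ∀ t ∈ Ico 0 T, U t = u t :=
    BlowupClayUniqueness_holds ν hν u₀ hdec U u P p T hT hUs hPs hns hE hmax.1 hLH hu0
  exact hmax.2 ⟨T + 1, by linarith, U, P,
    hU.mono (fun t ht => ht.1) (uniqueDiffOn_Ico 0 (T + 1)), heq⟩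

/-- **Crux ⇒ ¬AX** (the proved kill edge of route `CertifiedBlowup`, `CertifiedBlowupKillEdge_holds`,
fed with the discharged Clay-class uniqueness `BlowupClayUniqueness_holds`): an axisymmetric
maximal Leray–Hopf blow-up refutes global regularity for rapidly decaying axisymmetric data.
[folklore] -/
theorem not_axisymmetricSwirlRegularity_of_certifiedBlowupAxisymBlowup
    (hC : CertifiedBlowupAxisymBlowup) :
    ¬ Literature.Analysis.FluidPDE.AxisymmetricSwirlRegularity := fun hAX =>
  CertifiedBlowupKillEdge_holds hAX BlowupClayUniqueness_holds hC

/-- **¬AX ⇒ crux** (through the datum-wise Clay dichotomy `clayOrBlowup`): if some rapidly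
decaying axisymmetric datum has no global classical bounded-energy solution, then by `clayOrBlowup`
it launches a maximal Leray–Hopf classical solution of finite lifespan — a witness of
`CertifiedBlowupAxisymBlowup`. [folklore] -/
theorem certifiedBlowupAxisymBlowup_of_not_axisymmetricSwirlRegularity
    (hN : ¬ Literature.Analysis.FluidPDE.AxisymmetricSwirlRegularity) :
    CertifiedBlowupAxisymBlowup := by
  by_contra hC
  apply hN
  intro ν hν u₀ hsm hdiv hdec hax
  rcases clayOrBlowup ν hν u₀ hsm hdiv hdec with ⟨u, p, hcl, h0, hE⟩ | ⟨T, hT, u, p, hmax, hLH, h0⟩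
  · exact ⟨u, p, hcl, h0, hE⟩
  · exfalso
    apply hC
    refine ⟨ν, hν, T, hT, u, p, hmax, ?_, ?_, ?_⟩
    · rw [h0]; exact hLH
    · rw [h0]; exact hdec
    · rw [h0]; exact hax

/-- **The crux is exactly the negation of ns.S25.** `CertifiedBlowupAxisymBlowup` (X5a_axi:
some finite-energy classical Navier–Stokes solution from a rapidly decaying axisymmetric datum is
maximal with finite lifespan) holds iff the axisymmetric-with-swirl global regularity conjecture
`AxisymmetricSwirlRegularity` fails. (`→`: kill edge + Clay-class uniqueness; `←`: the Clay
dichotomy `clayOrBlowup`.) [folklore] -/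
theorem certifiedBlowupAxisymBlowup_iff_not_axisymmetricSwirlRegularity :
    Summit.NavierStokesRegularity.NavierStokesRegularity.Theses.CertifiedBlowup.CertifiedBlowupAxisymBlowup ↔
      ¬ Literature.Analysis.FluidPDE.AxisymmetricSwirlRegularity :=
  ⟨not_axisymmetricSwirlRegularity_of_certifiedBlowupAxisymBlowup,
    certifiedBlowupAxisymBlowup_of_not_axisymmetricSwirlRegularity⟩

/-- The same equivalence against the CANONICAL conjecture leaf
`Summit.NavierStokesRegularity.NavierStokesRegularity.AxisymmetricSwirlRegularity`
(`Theorems/AxisymmetricSwirlRegularity.lean`; same definiens as the transitional `Literature` copy).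
[folklore] -/
theorem certifiedBlowupAxisymBlowup_iff_not_axisymmetricSwirlRegularity_summit :
    Summit.NavierStokesRegularity.NavierStokesRegularity.Theses.CertifiedBlowup.CertifiedBlowupAxisymBlowup ↔
      ¬ Summit.NavierStokesRegularity.NavierStokesRegularity.AxisymmetricSwirlRegularity :=
  certifiedBlowupAxisymBlowup_iff_not_axisymmetricSwirlRegularity

/-- The same equivalence against the route item `AxisymmetricSwirlRegularityWall`
(stmt-NavierStokesRegularity-11332, the kill wall of route `CertifiedBlowup`): the crux 0727 and
the wall 11332 are each other's negation. [folklore] -/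
theorem certifiedBlowupAxisymBlowup_iff_not_axisymmetricSwirlRegularityWall :
    Summit.NavierStokesRegularity.NavierStokesRegularity.Theses.CertifiedBlowup.CertifiedBlowupAxisymBlowup ↔
      ¬ Summit.NavierStokesRegularity.NavierStokesRegularity.Theses.CertifiedBlowup.AxisymmetricSwirlRegularityWall :=
  certifiedBlowupAxisymBlowup_iff_not_axisymmetricSwirlRegularity

/-- **C⁺ ⇔ crux.** The open stub `stub_amplification` of the line `compact-amplification`
(unbounded enstrophy amplification of Tao-class solutions over a compact axisymmetric Schwartz data
family) is equivalent to `CertifiedBlowupAxisymBlowup`: both directions are landed theorems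
(`certifiedBlowupAxisymBlowup_of_amplification`, `amplification_of_certifiedBlowupAxisymBlowup`).
[cite: Tao2011, Thm. 1.20 (vi)] -/
theorem amplification_iff_certifiedBlowupAxisymBlowup :
    (∃ ν : ℝ, 0 < ν ∧ ∃ C : ℕ → ℕ → ℝ, ∀ M : ℝ, ∃ T : ℝ, 0 < T ∧ T ≤ 1 ∧
      ∃ (u₀ : EuclideanSpace ℝ (Fin 3) → EuclideanSpace ℝ (Fin 3))
        (u : ℝ → EuclideanSpace ℝ (Fin 3) → EuclideanSpace ℝ (Fin 3))
        (p : ℝ → EuclideanSpace ℝ (Fin 3) → ℝ),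
        ContDiff ℝ ∞ u₀ ∧ VectorCalculus.IsDivFree u₀ ∧ IsAxisymmetric u₀ ∧
        (∀ (k K : ℕ) (x : EuclideanSpace ℝ (Fin 3)),
          (1 + ‖x‖) ^ K * ‖iteratedFDeriv ℝ k u₀ x‖ ≤ C k K) ∧
        IsTaoSolutionOn T ν u₀ u p ∧
        ∃ t ∈ Set.Icc 0 T, ENNReal.ofReal M < ∫⁻ x, ‖fderiv ℝ (u t) x‖ₑ ^ 2) ↔
    Summit.NavierStokesRegularity.NavierStokesRegularity.Theses.CertifiedBlowup.CertifiedBlowupAxisymBlowup :=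
  ⟨certifiedBlowupAxisymBlowup_of_amplification, amplification_of_certifiedBlowupAxisymBlowup⟩

/-- **C⁺ ⇔ ¬AX.** The open stub of the line is exactly the failure of the axisymmetric-with-swirl
regularity conjecture ns.S25 (`amplification_iff_certifiedBlowupAxisymBlowup` composed with
`certifiedBlowupAxisymBlowup_iff_not_axisymmetricSwirlRegularity`). [cite: Tao2011, Thm. 1.20 (vi)] -/
theorem amplification_iff_not_axisymmetricSwirlRegularity :
    (∃ ν : ℝ, 0 < ν ∧ ∃ C : ℕ → ℕ → ℝ, ∀ M : ℝ, ∃ T : ℝ, 0 < T ∧ T ≤ 1 ∧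
      ∃ (u₀ : EuclideanSpace ℝ (Fin 3) → EuclideanSpace ℝ (Fin 3))
        (u : ℝ → EuclideanSpace ℝ (Fin 3) → EuclideanSpace ℝ (Fin 3))
        (p : ℝ → EuclideanSpace ℝ (Fin 3) → ℝ),
        ContDiff ℝ ∞ u₀ ∧ VectorCalculus.IsDivFree u₀ ∧ IsAxisymmetric u₀ ∧
        (∀ (k K : ℕ) (x : EuclideanSpace ℝ (Fin 3)),
          (1 + ‖x‖) ^ K * ‖iteratedFDeriv ℝ k u₀ x‖ ≤ C k K) ∧
        IsTaoSolutionOn T ν u₀ u p ∧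
        ∃ t ∈ Set.Icc 0 T, ENNReal.ofReal M < ∫⁻ x, ‖fderiv ℝ (u t) x‖ₑ ^ 2) ↔
    ¬ Literature.Analysis.FluidPDE.AxisymmetricSwirlRegularity :=
  amplification_iff_certifiedBlowupAxisymBlowup.trans
    certifiedBlowupAxisymBlowup_iff_not_axisymmetricSwirlRegularity

/-- **Qualitative ⇔ quantitative regularity inside the axisymmetric class** (Tao 2013,
Thm. 1.20 (vi), run on compact Schwartz families; the contrapositive reading of
`amplification_iff_not_axisymmetricSwirlRegularity`): the axisymmetric-with-swirl global regularity
conjecture ns.S25 holds iff, for every viscosity `ν > 0` and every table `C k K` of smoothness/decay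
constants, ONE level `M` bounds the enstrophy `∫ ‖∇u(t)‖²` of every Tao-class solution on every slab
`[0, T] ⊆ [0, 1]` from every axisymmetric divergence-free smooth datum obeying
`(1 + |x|)^K ‖Dᵏu₀(x)‖ ≤ C k K` — an a-priori `H¹` bound uniform over the compact data family.
[cite: Tao2011, Thm. 1.20 (vi)] -/
theorem axisymmetricSwirlRegularity_iff_apriori_enstrophy_bound :
    Literature.Analysis.FluidPDE.AxisymmetricSwirlRegularity ↔
      ∀ ν : ℝ, 0 < ν → ∀ C : ℕ → ℕ → ℝ, ∃ M : ℝ, ∀ T : ℝ, 0 < T → T ≤ 1 →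
        ∀ (u₀ : EuclideanSpace ℝ (Fin 3) → EuclideanSpace ℝ (Fin 3))
          (u : ℝ → EuclideanSpace ℝ (Fin 3) → EuclideanSpace ℝ (Fin 3))
          (p : ℝ → EuclideanSpace ℝ (Fin 3) → ℝ),
          ContDiff ℝ ∞ u₀ → VectorCalculus.IsDivFree u₀ → IsAxisymmetric u₀ →
          (∀ (k K : ℕ) (x : EuclideanSpace ℝ (Fin 3)),
            (1 + ‖x‖) ^ K * ‖iteratedFDeriv ℝ k u₀ x‖ ≤ C k K) →
          IsTaoSolutionOn T ν u₀ u p →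
          ∀ t ∈ Set.Icc 0 T, ∫⁻ x, ‖fderiv ℝ (u t) x‖ₑ ^ 2 ≤ ENNReal.ofReal M := by
  have h := amplification_iff_not_axisymmetricSwirlRegularity
  constructor
  · intro hAX ν hν C
    by_contra hcon
    refine (h.1 ⟨ν, hν, C, fun M => ?_⟩) hAX
    by_contra hM
    apply hcon
    refine ⟨M, fun T hT0 hT1 u₀ u p hsm hdiv hax hdec htao t ht => ?_⟩
    by_contra hlt
    exact hM ⟨T, hT0, hT1, u₀, u, p, hsm, hdiv, hax, hdec, htao, t, ht, not_le.1 hlt⟩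
  · intro hB
    by_contra hAX
    obtain ⟨ν, hν, C, hamp⟩ := h.2 hAX
    obtain ⟨M, hM⟩ := hB ν hν C
    obtain ⟨T, hT0, hT1, u₀, u, p, hsm, hdiv, hax, hdec, htao, t, ht, hbig⟩ := hamp M
    exact absurd (hM T hT0 hT1 u₀ u p hsm hdiv hax hdec htao t ht) (not_le.2 hbig)

end Summit.NavierStokesRegularity.NavierStokesRegularity.Theorems.CertifiedBlowupAxisymBlowup.CompactAmplification

end
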